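import Summits.PneNP.PneNP.Theorems.ChebyshevTracialDesignLevelMarginals
import Summits.PneNP.PneNP.Theorems.ChebyshevTracialDesignJuntaVirtualPositivity
import Literature.Combinatorics.Optimization.OddCutShellStep
import Literature.Combinatorics.Optimization.ExactDesignRemainder
import HarnessLib

/-!
# Cell pnp-psdrank, route `ChebyshevTracialDesign`: SHELL-OPERATOR FORM OF THE DESIGN VALUE AT A MATCHING — for ANY cut statistic `g`,
# `Σ_U W(U,M)·g(U) = −|PM|⁻¹·E_{Shell_1(M)}[(K^{−1/2})_{≤D} g] ± |PM|⁻¹·B_v·C((T−1)/2, D+1)·‖(K−I)^{D+1} g‖`, `K` the move-average operator of `M`: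
# the virtual level is half a move below the tight shell, and per-matching pricing of every mask is an estimate on the `(D+1)`-st power of
# the shell Laplacian (crux `TracialDecayExp20`, stmt-PneNP-19878)

Brick 111 (prover g20; composes lit g30's `OddCutShellStep` (shell-step identity) and `ExactDesignRemainder` §5 (odd-level Newton remainder) with the
route's planted weights; eng MEMO-18 §5 (P2)/(P3); MEMO-23 §3). `Shell_c(M) = {U : |U| = t, |half(U)| = c}` is Rothvoß's level class at `M`; the
MOVE-AVERAGE OPERATOR of `M` is `(K g)(U) = (Σ_{b∈full(U)} Σ_{a∈free(U)} g(U − b + a)) / (|full(U)|·|free(U)|)` (Markov, raises the level by `2`).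
* §1 (abstract step operator) **`shellAvg_iterate`**: `E_{Shell_{c+2}}[·] = E_{Shell_c}[K ·]` for `c ≤ cmax` ⇒ `E_{Shell_{c+2k}}[g] = E_{Shell_c}[K^k g]`;
  **`fwdDiff_iter_shellAvg`**: the odd-level profile `ψ_g(j) = E_{Shell_{2j+1}}[g]` has `Δ^k ψ_g(j) = E_{Shell_{2j+1}}[(K − I)^k g]`.
* §2 **`shellAvg_succ_eq_moveAvg`** (the move-average operator realises the step: Literature `ShellStep.shellStep_avg` with the `U`-intrinsic
  normalisation `|full(U)|·|free(U)| = (t−c)(n−t−c)`), `sum_oddSet_shell` (odd cuts at a level ↔ the shell as plain sets), **`card_shell_partner`**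
  (`|Shell_c(M)| = C(N,c+i)C(c+i,i)2^c`, `c + 2i = t`, `N = n/2`), `shell_partner_nonempty`, **`moveAvg_step`** (the one-step identity at EVERY level
  `c ≤ cmax` when `t` is odd, `cmax + 1 ≤ t`, `t + cmax + 1 ≤ n`; even levels are empty on both sides).
* §3 **`designValue_eq_shellAvg`**: `Σ_U W(U,M)·g(U) = |PM|⁻¹·Σ_{c∈C} w_c·E_{Shell_c(M)}[g]` (`|Q_c| = |PM|·|Shell_c(M)|`, brick `…LevelMarginals`);
  **`designValue_operator_bound`** / **`…_sup`**: for an exact design `(n,t,T,D,B_v,C,w)` and any `K` with the one-step property up to `T − 2`,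
  `|Σ_U W(U,M)g(U) + |PM|⁻¹·N^{odd}_D φ_M(0)| ≤ |PM|⁻¹·B_v·C((T−1)/2, D+1)·R` whenever `|E_{Shell_{2j+1}(M)}[(K−I)^{D+1}g]| ≤ R` (resp.
  `‖(K−I)^{D+1}g‖_∞ ≤ R` on `t`-sets), `φ_M(c) = E_{Shell_c(M)}[g]`, `N^{odd}_D` the step-2 Newton interpolant at `1,3,…,2D+1`
  (Literature `IsExactDesign.abs_levelSum_add_le_of_fwdDiff_odd` + §1).
* §4 `prod_neg_half_sub`, **`chooseXOdd_eval_zero`** (`C((X−1)/2,k)(0) = C(−1/2,k) = (−1)^k C(2k,k)/4^k`), **`newtonPolyOdd_eval_zero_eq_series`**: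
  `N^{odd}_D φ_M(0) = Σ_{k=0}^{D} (−1)^k (C(2k,k)/4^k)·E_{Shell_1(M)}[(K−I)^k g]` — THE VIRTUAL VALUE IS THE DEGREE-`D` TRUNCATION OF
  `E_{Shell_1(M)}[(I + (K−I))^{−1/2} g]`: the virtual level `c = 0` is half a move below the tight shell; **`…_of_tight`**: for `g = 0` on `Shell_1(M)`
  (e.g. `g(U) = tr(X_U Y_M)` of a tight-orthogonal psd rectangle) the series starts at `k = 1` (leading term `+½·E_{Shell_1}[Kg] = ½·E_{Shell_3}[g]`).
* §5 **`designValue_moveAvg_bound_sup`**: the concrete per-matching bound with the move-average operator (no operator hypothesis left).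
READING (MEMO-23 §3): per matching, pricing ANY mask `g` is (a) the SIGN of the `K^{−1/2}` series on the tight shell plus (b) a smoothing estimate
`E_{Shell}[(K−I)^{D+1}g] ≲ e^{−aD}` for the move chain of `M` — bricks 110a–c read (b) off pattern polynomials (juntas); for block statistics at
`|H| ≍ n` (eng CG1SYM, lit LIT-43 §2(c): `N^{−3/2}` per order) it is the open analytic core, now a statement about ONE explicit Markov operator.
[cite: Rothvoss2017, §2 (PDF p. 6)] [cite: GodsilMeagher2015, §15.2] [cite: Agarwal2000DifferenceEquations, Thm. 1.8.5 (1.8.6), Remark 1.8.1 (1.8.8)]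
[cite: Rivlin1974, Sect. 1.3 (1.32)–(1.34)] [cite: GriblingDelaatLaurent2019, §5]
Stature: support/instrument (kernel lane, no defs, axioms standard). WHAT THIS IS NOT: no estimate on `(K−I)^{D+1}g` for any non-junta `g` is proved
here, no proof or refutation of `TracialDecayExp20`, nothing on psd rank of P_PM(K_n), no P-vs-NP content. Supports stmt-PneNP-19878.
-/

set_option linter.dupNamespace false -- `Summit.PneNP.PneNP.…`: summit = sub-problem (D-0017)

noncomputable section

namespace Summit.PneNP.PneNP.Theorems.ChebyshevTracialDesignShellOperatorForm

open Finset Polynomial Literature.Barriers.PneNP Literature.Combinatorics.Optimization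
open Literature.Combinatorics.Optimization.ShellStep
open Summit.PneNP.PneNP.Theorems.ChebyshevTracialDesignLevelMarginals (card_Qset_eq_colCount_mul)
open Summit.PneNP.PneNP.Theorems.ChebyshevTracialDesignJunta (two_mul_card_pmatch sum_oddSet_level_eq card_eq_cr_add_two_mul_in
  card_filter_cr_in_eq cc_eq_card_filter)

variable {n : ℕ}

/-! ### §1 The shell step as an operator identity, iterated -/

section Involution

variable {π : Fin n → Fin n}

/-- **Abstract step operator, iterated.** If an operator `K` on cut statistics satisfies the one-step identity
`E_{Shell_{c+2}}[g] = E_{Shell_c}[K g]` for all `g` at every level `c ≤ cmax`, then `E_{Shell_{c+2k}}[g] = E_{Shell_c}[K^k g]` whenever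
`c + 2k ≤ cmax + 2`. [cite: Rothvoss2017, §2 (PDF p. 6)] -/
theorem shellAvg_iterate (t cmax : ℕ) (K : (Finset (Fin n) → ℝ) → (Finset (Fin n) → ℝ))
    (hK : ∀ c, c ≤ cmax → ∀ g : Finset (Fin n) → ℝ,
      (∑ U' ∈ shell π t (c + 2), g U') / (shell π t (c + 2)).card = (∑ U ∈ shell π t c, K g U) / (shell π t c).card) :
    ∀ (k c : ℕ), c + 2 * k ≤ cmax + 2 → ∀ g : Finset (Fin n) → ℝ,
      (∑ U' ∈ shell π t (c + 2 * k), g U') / (shell π t (c + 2 * k)).card = (∑ U ∈ shell π t c, (K^[k] g) U) / (shell π t c).card := by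
  intro k
  induction k with
  | zero => intro c _ g; simp
  | succ k ih =>
      intro c hc g
      rw [show c + 2 * (k + 1) = (c + 2) + 2 * k by ring, ih (c + 2) (by omega) g, hK c (by omega) (K^[k] g),
        ← Function.iterate_succ_apply' K k g]

/-- **Differences of an odd-level profile are shell averages of powers of `K − I`.** Under the one-step identity at all levels `c ≤ cmax`, the
profile `ψ_g(j) = E_{Shell_{2j+1}}[g]` satisfies `Δ^k ψ_g(j) = E_{Shell_{2j+1}}[(K − I)^k g]` whenever `2(j+k)+1 ≤ cmax + 2`.
[cite: Rothvoss2017, §2 (PDF p. 6)] [cite: Agarwal2000DifferenceEquations, Thm. 1.8.5 (1.8.6)] -/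
theorem fwdDiff_iter_shellAvg (t cmax : ℕ) (K : (Finset (Fin n) → ℝ) → (Finset (Fin n) → ℝ))
    (hK : ∀ c, c ≤ cmax → ∀ g : Finset (Fin n) → ℝ,
      (∑ U' ∈ shell π t (c + 2), g U') / (shell π t (c + 2)).card = (∑ U ∈ shell π t c, K g U) / (shell π t c).card) :
    ∀ (k j : ℕ), 2 * (j + k) + 1 ≤ cmax + 2 → ∀ g : Finset (Fin n) → ℝ,
      ((fwdDiff (1 : ℕ))^[k] (fun j : ℕ => (∑ U ∈ shell π t (2 * j + 1), g U) / (shell π t (2 * j + 1)).card)) j =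
        (∑ U ∈ shell π t (2 * j + 1), ((fun h : Finset (Fin n) → ℝ => K h - h)^[k] g) U) / (shell π t (2 * j + 1)).card := by
  intro k
  induction k with
  | zero => intro j _ g; simp
  | succ k ih =>
      intro j hj g
      rw [Function.iterate_succ_apply', fwdDiff, ih (j + 1) (by omega) g, ih j (by omega) g, Function.iterate_succ_apply']
      -- one step at level `2j+1` for the function `(K-I)^k g`
      set h : Finset (Fin n) → ℝ := (fun h : Finset (Fin n) → ℝ => K h - h)^[k] g with hh
      rw [show 2 * (j + 1) + 1 = (2 * j + 1) + 2 by ring, hK (2 * j + 1) (by omega) h, ← sub_div, ← sum_sub_distrib]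
      rfl

end Involution

/-! ### §2 The move-average operator realises the step; shells of a perfect matching -/

section Matching

/-- **The move-average operator realises the shell step**: with `(K g)(U) = (Σ_{b∈full(U)} Σ_{a∈free(U)} g(U−b+a))/(|full(U)|·|free(U)|)` (a
`U`-intrinsic normalisation, `= (t−c)(n−t−c)` on `Shell_c`), `E_{Shell_{c+2}}[g] = E_{Shell_c}[K g]` whenever `Shell_c ≠ ∅`, `c+1 ≤ t`, `t+c+1 ≤ n`
(Literature `ShellStep.shellStep_avg`). [cite: Rothvoss2017, §2 (PDF p. 6)] -/
theorem shellAvg_succ_eq_moveAvg {π : Fin n → Fin n} (hπ : ∀ v, π (π v) = v) (hπ' : ∀ v, π v ≠ v) {t c : ℕ}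
    (hne : (shell π t c).Nonempty) (hct : c + 1 ≤ t) (hn : t + c + 1 ≤ n) (g : Finset (Fin n) → ℝ) :
    (∑ U' ∈ shell π t (c + 2), g U') / (shell π t (c + 2)).card =
      (∑ U ∈ shell π t c, (∑ b ∈ full π U, ∑ a ∈ free π U, g (move U b a)) / (((full π U).card : ℝ) * (free π U).card)) /
        (shell π t c).card := by
  rw [shellStep_avg hπ hπ' hne hct hn g]
  congr 1
  refine sum_congr rfl fun U hU => ?_
  rw [card_full_of_mem_shell hU, card_free_of_mem_shell hπ hU, Nat.cast_sub (by omega), Nat.cast_sub (by omega),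
    Nat.cast_sub (by omega)]

/-- Odd cuts at a level of a matching, as plain sets: `Σ_{U : OddSet, |U| = t, cc(U,M) = c} F(U) = Σ_{U ∈ Shell_c(M)} F(U)` for odd `t`.
[cite: Rothvoss2017, §2 (PDF p. 6)] -/
theorem sum_oddSet_shell (M : PMatch n) {t c : ℕ} (ht : Odd t) (F : Finset (Fin n) → ℝ) :
    ∑ U : OddSet n, (if U.1.card = t ∧ cc U M = c then F U.1 else 0) = ∑ U' ∈ shell M.2.partner t c, F U' := by
  classical
  have h1 : ∑ U : OddSet n, (if U.1.card = t ∧ cc U M = c then F U.1 else 0) =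
      ∑ U : OddSet n, (fun S : Finset (Fin n) => if S ∈ shell M.2.partner t c then F S else 0) U.1 :=
    Fintype.sum_congr _ _ fun U => by simp only [← mem_shell_partner_iff U M]
  have h2 : ∑ S ∈ (univ : Finset (Finset (Fin n))).filter (fun S => Odd S.card),
      (fun S : Finset (Fin n) => if S ∈ shell M.2.partner t c then F S else 0) S =
      ∑ U : OddSet n, (fun S : Finset (Fin n) => if S ∈ shell M.2.partner t c then F S else 0) U.1 :=
    sum_subtype _ (fun S => by simp) _
  rw [h1, ← h2, ← sum_filter, filter_filter]
  refine sum_congr ?_ fun _ _ => rfl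
  ext S
  simp only [mem_filter, mem_univ, true_and, mem_shell]
  constructor
  · rintro ⟨-, h⟩; exact h
  · rintro h; exact ⟨by rw [h.1]; exact ht, h⟩

/-- **The size of a shell of a perfect matching**: `|Shell_c(M)| = C(N, c+i)·C(c+i, i)·2^c` for `c + 2i = t`, `N = n/2` (`t` odd).
[cite: Rothvoss2017, §2 (PDF p. 6)] -/
theorem card_shell_partner (M : PMatch n) {t c i : ℕ} (ht : Odd t) (hci : c + 2 * i = t) :
    ((shell M.2.partner t c).card : ℝ) = (((n / 2).choose (c + i) * (c + i).choose i * 2 ^ c : ℕ) : ℝ) := by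
  classical
  have hN : M.1.card = n / 2 := by have := two_mul_card_pmatch M; omega
  have key := sum_oddSet_level_eq M hci (r := 1) (fun _ => 1) (fun _ => 1)
  simp only [Matrix.mul_one, Matrix.trace_one, Fintype.card_fin, Nat.cast_one, dite_eq_ite] at key
  have hodd : ∀ U' ∈ (univ : Finset (Fin n)).powerset.filter (fun U' =>
      (M.1.filter fun e => cutCount U' e = 1).card = c ∧ (M.1.filter fun e => cutCount U' e = 2).card = i),
      (if Odd U'.card then (1 : ℝ) else 0) = 1 := by
    intro U' hU'
    rw [mem_filter] at hU'
    have hc := card_eq_cr_add_two_mul_in M.2 (subset_univ U')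
    rw [hU'.2.1, hU'.2.2, hci] at hc
    rw [if_pos (hc ▸ ht)]
  rw [sum_congr rfl hodd, sum_const, nsmul_eq_mul, mul_one, card_filter_cr_in_eq M.2, hN] at key
  rw [← key, sum_oddSet_shell M ht (fun _ => (1 : ℝ)), sum_const, nsmul_eq_mul, mul_one]

/-- Shells of a perfect matching are nonempty at every odd level `c ≤ t` with `t + c ≤ n` (`t` odd). [cite: Rothvoss2017, §2 (PDF p. 6)] -/
theorem shell_partner_nonempty (M : PMatch n) {t c : ℕ} (ht : Odd t) (hc : Odd c) (hct : c ≤ t) (hn : t + c ≤ n) :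
    (shell M.2.partner t c).Nonempty := by
  obtain ⟨i, hci⟩ : ∃ i, c + 2 * i = t := by
    obtain ⟨a, ha⟩ := hc; obtain ⟨b, hb⟩ := ht; exact ⟨b - a, by omega⟩
  have hN : 2 * (n / 2) = n := by have := two_mul_card_pmatch M; omega
  rw [← card_pos, ← Nat.cast_pos (α := ℝ), card_shell_partner M ht hci]
  have h1 : 0 < (n / 2).choose (c + i) := Nat.choose_pos (by omega)
  have h2 : 0 < (c + i).choose i := Nat.choose_pos (by omega)
  positivity

/-- The one-step identity for the move-average operator of a perfect matching at EVERY level `c ≤ cmax` (empty shells included: both sides vanish),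
provided `t` is odd, `cmax + 1 ≤ t` and `t + cmax + 1 ≤ n`. [cite: Rothvoss2017, §2 (PDF p. 6)] -/
theorem moveAvg_step (M : PMatch n) {t cmax : ℕ} (ht : Odd t) (hct : cmax + 1 ≤ t) (hn : t + cmax + 1 ≤ n) :
    ∀ c, c ≤ cmax → ∀ g : Finset (Fin n) → ℝ,
      (∑ U' ∈ shell M.2.partner t (c + 2), g U') / (shell M.2.partner t (c + 2)).card =
        (∑ U ∈ shell M.2.partner t c, (fun (g : Finset (Fin n) → ℝ) (U : Finset (Fin n)) =>
          (∑ b ∈ full M.2.partner U, ∑ a ∈ free M.2.partner U, g (move U b a)) /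
            (((full M.2.partner U).card : ℝ) * (free M.2.partner U).card)) g U) / (shell M.2.partner t c).card := by
  intro c hc g
  rcases Nat.even_or_odd c with hce | hco
  · -- even level: both shells are empty (`|half(U)| ≡ |U| = t (mod 2)`)
    have hempty : ∀ c', Even c' → shell M.2.partner t c' = ∅ := by
      intro c' hc'
      rw [eq_empty_iff_forall_notMem]
      intro U hU
      obtain ⟨hUt, hUc⟩ := mem_shell.1 hU
      have hodd : Odd U.card := by rw [hUt]; exact ht
      have h1 := card_eq_cr_add_two_mul_in M.2 (subset_univ U)
      have h2 : cc ⟨U, hodd⟩ M = (half M.2.partner U).card := cc_eq_card_half ⟨U, hodd⟩ M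
      have h3 : cc ⟨U, hodd⟩ M = (M.1.filter fun e => cutCount U e = 1).card := cc_eq_card_filter ⟨U, hodd⟩ M
      obtain ⟨k, hk⟩ := hc'
      obtain ⟨m, hm⟩ := hodd
      omega
    rw [hempty c hce, hempty (c + 2) (by obtain ⟨k, hk⟩ := hce; exact ⟨k + 1, by omega⟩)]
    simp
  · exact shellAvg_succ_eq_moveAvg (partner_partner M) (partner_ne M)
      (shell_partner_nonempty M ht hco (by omega) (by omega)) (by omega) (by omega) g

/-! ### §3 The design value at a matching in operator form -/

/-- **The design value at one matching is the design applied to the shell profile**: for odd `t` and any cut statistic `g`,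
`Σ_U W(U,M)·g(U) = |PM|⁻¹·Σ_{c∈C} w_c·E_{Shell_c(M)}[g]` (the planted weight `W = Σ_c w_c 1[Q_c]/|Q_c|`, `|Q_c| = |PM|·|Shell_c(M)|`).
[cite: Rothvoss2017, §2 (PDF p. 6, eq. (2))] -/
theorem designValue_eq_shellAvg (t : ℕ) (ht : Odd t) (C : Finset ℕ) (w : ℕ → ℝ) (M : PMatch n) (g : Finset (Fin n) → ℝ) :
    ∑ U : OddSet n, levelWeight n t C w U M * g U.1 =
      (Fintype.card (PMatch n) : ℝ)⁻¹ * ∑ c ∈ C, w c * ((∑ U' ∈ shell M.2.partner t c, g U') / (shell M.2.partner t c).card) := by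
  classical
  have hcol : ∀ c, ((Qset n t c).card : ℝ) = ((shell M.2.partner t c).card : ℝ) * Fintype.card (PMatch n) := by
    intro c
    rw [card_Qset_eq_colCount_mul t c M]
    congr 1
    have h := sum_oddSet_shell M ht (c := c) (fun _ => (1 : ℝ))
    rw [sum_const, nsmul_eq_mul, mul_one] at h
    rw [← h, ← sum_filter, sum_const, nsmul_eq_mul, mul_one]
  calc ∑ U : OddSet n, levelWeight n t C w U M * g U.1
      = ∑ U : OddSet n, ∑ c ∈ C, (if U.1.card = t ∧ cc U M = c then w c / ((Qset n t c).card : ℝ) * g U.1 else 0) := by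
        refine Fintype.sum_congr _ _ fun U => ?_
        rw [levelWeight, sum_mul]
        refine sum_congr rfl fun c _ => ?_
        simp only [mem_Qset_iff]
        split_ifs <;> simp
    _ = ∑ c ∈ C, ∑ U : OddSet n, (if U.1.card = t ∧ cc U M = c then w c / ((Qset n t c).card : ℝ) * g U.1 else 0) := sum_comm
    _ = ∑ c ∈ C, w c / ((Qset n t c).card : ℝ) * ∑ U' ∈ shell M.2.partner t c, g U' := by
        refine sum_congr rfl fun c _ => ?_
        rw [← sum_oddSet_shell M ht, mul_sum]
        refine Fintype.sum_congr _ _ fun U => ?_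
        split_ifs <;> simp
    _ = (Fintype.card (PMatch n) : ℝ)⁻¹ * ∑ c ∈ C, w c * ((∑ U' ∈ shell M.2.partner t c, g U') / (shell M.2.partner t c).card) := by
        rw [mul_sum]
        refine sum_congr rfl fun c _ => ?_
        rw [hcol c]
        rcases eq_or_ne ((shell M.2.partner t c).card : ℝ) 0 with h0 | h0
        · have hempty : shell M.2.partner t c = ∅ := by
            rw [← card_eq_zero]; exact_mod_cast h0
          rw [hempty]; simp
        · rcases eq_or_ne (Fintype.card (PMatch n) : ℝ) 0 with hP | hP
          · rw [hP]; simp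
          · field_simp

/-- **SHELL-OPERATOR FORM OF THE DESIGN VALUE AT A MATCHING.** Let `(n, t, T, D, B_v, C, w)` be an exact design, `M` a perfect matching,
`g` ANY cut statistic, and `K` an operator with the one-step property `E_{Shell_{c+2}(M)}[g'] = E_{Shell_c(M)}[K g']` for all `g'` and all
`c ≤ T − 2` (e.g. the move-average operator, `moveAvg_step`). If `|E_{Shell_{2j+1}(M)}[(K − I)^{D+1} g]| ≤ R` for `2(j+D+1)+1 ≤ T`, then
`|Σ_U W(U,M)·g(U) + |PM|⁻¹·N^{odd}_D φ_M(0)| ≤ |PM|⁻¹·B_v·C((T−1)/2, D+1)·R`, where `φ_M(c) = E_{Shell_c(M)}[g]` and `N^{odd}_D φ_M` is its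
step-2 Newton interpolant at the nodes `1, 3, …, 2D+1` (Literature `DesignRemainder.newtonPolyOdd`): the per-matching design value of an
arbitrary statistic is minus its extrapolated virtual value, up to a remainder controlled by the `(D+1)`-ST POWER OF THE SHELL LAPLACIAN `K − I`.
[cite: Rothvoss2017, §2 (PDF p. 6)] [cite: Agarwal2000DifferenceEquations, Remark 1.8.1 (1.8.8)] [cite: Rivlin1974, Sect. 1.3 (1.32)–(1.34)] -/
theorem designValue_operator_bound {t T D : ℕ} {Bv : ℝ} {C : Finset ℕ} {w : ℕ → ℝ} (hdes : IsExactDesign n t T D Bv C w)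
    (M : PMatch n) (g : Finset (Fin n) → ℝ) (K : (Finset (Fin n) → ℝ) → (Finset (Fin n) → ℝ))
    (hK : ∀ c, c ≤ T - 2 → ∀ g' : Finset (Fin n) → ℝ,
      (∑ U' ∈ shell M.2.partner t (c + 2), g' U') / (shell M.2.partner t (c + 2)).card =
        (∑ U ∈ shell M.2.partner t c, K g' U) / (shell M.2.partner t c).card)
    {R : ℝ} (hR0 : 0 ≤ R)
    (hR : ∀ j : ℕ, 2 * (j + D + 1) + 1 ≤ T →
      |(∑ U ∈ shell M.2.partner t (2 * j + 1), ((fun h : Finset (Fin n) → ℝ => K h - h)^[D + 1] g) U) /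
          (shell M.2.partner t (2 * j + 1)).card| ≤ R) :
    |∑ U : OddSet n, levelWeight n t C w U M * g U.1 +
        (Fintype.card (PMatch n) : ℝ)⁻¹ * (DesignRemainder.newtonPolyOdd D
          (fun c => (∑ U' ∈ shell M.2.partner t c, g U') / (shell M.2.partner t c).card)).eval 0| ≤
      (Fintype.card (PMatch n) : ℝ)⁻¹ * (Bv * ((((T - 1) / 2).choose (D + 1) : ℕ) : ℝ) * R) := by
  have ht : Odd t := hdes.1
  set φ : ℕ → ℝ := fun c => (∑ U' ∈ shell M.2.partner t c, g U') / (shell M.2.partner t c).card with hφ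
  have hdiff : ∀ j : ℕ, 2 * (j + D + 1) + 1 ≤ T →
      |((fwdDiff (1 : ℕ))^[D + 1] (fun j => φ (2 * j + 1))) j| ≤ R := by
    intro j hj
    have h := fwdDiff_iter_shellAvg t (T - 2) K hK (D + 1) j (by omega) g
    rw [hφ]
    rw [h]
    exact hR j hj
  have h := hdes.abs_levelSum_add_le_of_fwdDiff_odd φ hR0 hdiff
  rw [designValue_eq_shellAvg t ht C w M g, ← mul_add, abs_mul, abs_of_nonneg (inv_nonneg.2 (Nat.cast_nonneg _))]
  exact mul_le_mul_of_nonneg_left h (inv_nonneg.2 (Nat.cast_nonneg _))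

/-- Sup-norm form: if `|((K − I)^{D+1} g)(U)| ≤ R` for every `t`-set `U`, the same conclusion holds (shell averages are bounded by the sup).
[cite: Rothvoss2017, §2 (PDF p. 6)] [cite: Agarwal2000DifferenceEquations, Remark 1.8.1 (1.8.8)] -/
theorem designValue_operator_bound_sup {t T D : ℕ} {Bv : ℝ} {C : Finset ℕ} {w : ℕ → ℝ} (hdes : IsExactDesign n t T D Bv C w)
    (M : PMatch n) (g : Finset (Fin n) → ℝ) (K : (Finset (Fin n) → ℝ) → (Finset (Fin n) → ℝ))
    (hK : ∀ c, c ≤ T - 2 → ∀ g' : Finset (Fin n) → ℝ,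
      (∑ U' ∈ shell M.2.partner t (c + 2), g' U') / (shell M.2.partner t (c + 2)).card =
        (∑ U ∈ shell M.2.partner t c, K g' U) / (shell M.2.partner t c).card)
    {R : ℝ} (hR0 : 0 ≤ R) (hR : ∀ U : Finset (Fin n), U.card = t → |((fun h : Finset (Fin n) → ℝ => K h - h)^[D + 1] g) U| ≤ R) :
    |∑ U : OddSet n, levelWeight n t C w U M * g U.1 +
        (Fintype.card (PMatch n) : ℝ)⁻¹ * (DesignRemainder.newtonPolyOdd D
          (fun c => (∑ U' ∈ shell M.2.partner t c, g U') / (shell M.2.partner t c).card)).eval 0| ≤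
      (Fintype.card (PMatch n) : ℝ)⁻¹ * (Bv * ((((T - 1) / 2).choose (D + 1) : ℕ) : ℝ) * R) := by
  refine designValue_operator_bound hdes M g K hK hR0 fun j _ => ?_
  set S := shell M.2.partner t (2 * j + 1) with hS
  rcases S.eq_empty_or_nonempty with h0 | hne
  · rw [h0]; simp [hR0]
  · have hScard : (0 : ℝ) < S.card := by exact_mod_cast hne.card_pos
    rw [abs_div, Nat.abs_cast, div_le_iff₀ hScard]
    calc |∑ U ∈ S, ((fun h : Finset (Fin n) → ℝ => K h - h)^[D + 1] g) U|
        ≤ ∑ U ∈ S, |((fun h : Finset (Fin n) → ℝ => K h - h)^[D + 1] g) U| := abs_sum_le_sum_abs _ _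
      _ ≤ ∑ _U ∈ S, R := sum_le_sum fun U hU => hR U (mem_shell.1 hU).1
      _ = R * S.card := by rw [sum_const, nsmul_eq_mul, mul_comm]

end Matching

/-! ### §4 The virtual value as an operator series: `K^{-1/2}` from the tight shell -/

section Series

/-- `Π_{j<k} (−1/2 − j) · 4^k · k! = (−1)^k (2k)!`. [folklore] -/
theorem prod_neg_half_sub (k : ℕ) :
    (∏ j ∈ range k, (-(1 : ℝ) / 2 - j)) * ((4 : ℝ) ^ k * (k.factorial : ℝ)) = (-1 : ℝ) ^ k * ((2 * k).factorial : ℝ) := by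
  induction k with
  | zero => simp
  | succ k ih =>
      rw [prod_range_succ, pow_succ, Nat.factorial_succ, show 2 * (k + 1) = (2 * k + 1) + 1 by ring, Nat.factorial_succ,
        Nat.factorial_succ (2 * k)]
      push_cast
      linear_combination ((-(1 : ℝ) / 2 - k) * 4 * (k + 1)) * ih

/-- **The step-2 binomial polynomial at the virtual level**: `C((X−1)/2, k)(0) = C(−1/2, k) = (−1)^k·C(2k,k)/4^k` — the coefficients of the
binomial series of `(1 + x)^{−1/2}`. [cite: Agarwal2000DifferenceEquations, Thm. 1.8.5 (1.8.6)] -/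
theorem chooseXOdd_eval_zero (k : ℕ) :
    (DesignRemainder.chooseXOdd k).eval 0 = (-1 : ℝ) ^ k * (((2 * k).choose k : ℕ) : ℝ) / (4 : ℝ) ^ k := by
  rw [DesignRemainder.chooseXOdd, eval_comp, DesignRemainder.chooseX, eval_mul, eval_C, descPochhammer_eval_eq_prod_range]
  have harg : (C (1 / 2 : ℝ) * (X - C 1)).eval (0 : ℝ) = -(1 : ℝ) / 2 := by simp; ring
  rw [harg]
  have hk : (k.factorial : ℝ) ≠ 0 := by positivity
  have h4 : (4 : ℝ) ^ k ≠ 0 := by positivity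
  have hprod := prod_neg_half_sub k
  have hch : (((2 * k).choose k : ℕ) : ℝ) * (k.factorial : ℝ) * (k.factorial : ℝ) = ((2 * k).factorial : ℝ) := by
    have := Nat.choose_mul_factorial_mul_factorial (show k ≤ 2 * k by omega)
    rw [show 2 * k - k = k by omega] at this
    exact_mod_cast this
  have hP : ∏ j ∈ range k, (-(1 : ℝ) / 2 - j) = (-1 : ℝ) ^ k * ((2 * k).factorial : ℝ) / ((4 : ℝ) ^ k * (k.factorial : ℝ)) := by
    rw [eq_div_iff (mul_ne_zero h4 hk), hprod]
  rw [hP, ← hch]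
  field_simp

variable {π : Fin n → Fin n}

/-- **THE VIRTUAL VALUE IS `K^{−1/2}` FROM THE TIGHT SHELL.** Under the one-step identity `E_{Shell_{c+2}}[·] = E_{Shell_c}[K ·]` for `c ≤ cmax` with
`2D + 1 ≤ cmax + 2`, the extrapolated virtual value of the profile `φ(c) = E_{Shell_c}[g]` is the truncated binomial series
`N^{odd}_D φ(0) = Σ_{k=0}^{D} C(−1/2, k)·E_{Shell_1}[(K − I)^k g] = Σ_{k=0}^{D} (−1)^k (C(2k,k)/4^k)·E_{Shell_1}[(K − I)^k g]` — the degree-`D` truncation of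
`E_{Shell_1}[(I + (K − I))^{−1/2} g]`: the virtual level `c = 0` sits half a move below the tight shell `c = 1`.
[cite: Agarwal2000DifferenceEquations, Thm. 1.8.5 (1.8.6)] [cite: Rothvoss2017, §2 (PDF p. 6)] -/
theorem newtonPolyOdd_eval_zero_eq_series (t cmax D : ℕ) (hD : 2 * D + 1 ≤ cmax + 2) (K : (Finset (Fin n) → ℝ) → (Finset (Fin n) → ℝ))
    (hK : ∀ c, c ≤ cmax → ∀ g : Finset (Fin n) → ℝ,
      (∑ U' ∈ shell π t (c + 2), g U') / (shell π t (c + 2)).card = (∑ U ∈ shell π t c, K g U) / (shell π t c).card)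
    (g : Finset (Fin n) → ℝ) :
    (DesignRemainder.newtonPolyOdd D (fun c => (∑ U' ∈ shell π t c, g U') / (shell π t c).card)).eval 0 =
      ∑ k ∈ range (D + 1), ((-1 : ℝ) ^ k * (((2 * k).choose k : ℕ) : ℝ) / (4 : ℝ) ^ k) *
        ((∑ U ∈ shell π t 1, ((fun h : Finset (Fin n) → ℝ => K h - h)^[k] g) U) / (shell π t 1).card) := by
  rw [DesignRemainder.newtonPolyOdd_eq_sum, eval_finsetSum]
  refine sum_congr rfl fun k hk => ?_
  have hkD : k ≤ D := Nat.lt_succ_iff.1 (mem_range.1 hk)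
  rw [eval_mul, eval_C, chooseXOdd_eval_zero, mul_comm]
  congr 1
  have h := fwdDiff_iter_shellAvg t cmax K hK k 0 (by omega) g
  simpa using h

/-- For a statistic VANISHING ON THE TIGHT SHELL (`g = 0` on `Shell_1`, e.g. `g(U) = tr(X_U Y_M)` for a tight-orthogonal psd rectangle) the `k = 0`
term drops: `N^{odd}_D φ(0) = Σ_{k=1}^{D} (−1)^k (C(2k,k)/4^k)·E_{Shell_1}[(K − I)^k g]`. [cite: Rothvoss2017, §2 (PDF p. 6)]
[cite: Agarwal2000DifferenceEquations, Thm. 1.8.5 (1.8.6)] -/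
theorem newtonPolyOdd_eval_zero_eq_series_of_tight (t cmax D : ℕ) (hD : 2 * D + 1 ≤ cmax + 2)
    (K : (Finset (Fin n) → ℝ) → (Finset (Fin n) → ℝ))
    (hK : ∀ c, c ≤ cmax → ∀ g : Finset (Fin n) → ℝ,
      (∑ U' ∈ shell π t (c + 2), g U') / (shell π t (c + 2)).card = (∑ U ∈ shell π t c, K g U) / (shell π t c).card)
    (g : Finset (Fin n) → ℝ) (htight : ∀ U ∈ shell π t 1, g U = 0) :
    (DesignRemainder.newtonPolyOdd D (fun c => (∑ U' ∈ shell π t c, g U') / (shell π t c).card)).eval 0 =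
      ∑ k ∈ Ico 1 (D + 1), ((-1 : ℝ) ^ k * (((2 * k).choose k : ℕ) : ℝ) / (4 : ℝ) ^ k) *
        ((∑ U ∈ shell π t 1, ((fun h : Finset (Fin n) → ℝ => K h - h)^[k] g) U) / (shell π t 1).card) := by
  rw [newtonPolyOdd_eval_zero_eq_series t cmax D hD K hK g, ← sum_range_add_sum_Ico _ (by omega : 1 ≤ D + 1)]
  have h0 : ∑ U ∈ shell π t 1, g U = 0 := sum_eq_zero fun U hU => htight U hU
  rw [sum_range_one]
  simp [h0]

end Series

/-! ### §5 The move-average operator: the concrete per-matching bound -/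

section Concrete

/-- **PER-MATCHING PRICING OF AN ARBITRARY STATISTIC BY THE SHELL LAPLACIAN** (concrete form of `designValue_operator_bound_sup` with the
move-average operator `(K g)(U) = (Σ_{b∈full(U)} Σ_{a∈free(U)} g(U−b+a))/(|full(U)|·|free(U)|)` of `M`): for an exact design `(n,t,T,D,B_v,C,w)`, a
perfect matching `M` and ANY cut statistic `g` with `|((K − I)^{D+1} g)(U)| ≤ R` on the `t`-sets,
`|Σ_U W(U,M)·g(U) + |PM|⁻¹·N^{odd}_D φ_M(0)| ≤ |PM|⁻¹·B_v·C((T−1)/2, D+1)·R`, `φ_M(c) = E_{Shell_c(M)}[g]`. With §4, `N^{odd}_D φ_M(0)` is the `K^{−1/2}`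
series from the tight shell. [cite: Rothvoss2017, §2 (PDF p. 6)] [cite: Agarwal2000DifferenceEquations, Remark 1.8.1 (1.8.8)]
[cite: Rivlin1974, Sect. 1.3 (1.32)–(1.34)] -/
theorem designValue_moveAvg_bound_sup {t T D : ℕ} {Bv : ℝ} {C : Finset ℕ} {w : ℕ → ℝ} (hdes : IsExactDesign n t T D Bv C w)
    (M : PMatch n) (g : Finset (Fin n) → ℝ) {R : ℝ} (hR0 : 0 ≤ R)
    (hR : ∀ U : Finset (Fin n), U.card = t →
      |((fun h : Finset (Fin n) → ℝ => (fun U : Finset (Fin n) =>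
          (∑ b ∈ full M.2.partner U, ∑ a ∈ free M.2.partner U, h (move U b a)) /
            (((full M.2.partner U).card : ℝ) * (free M.2.partner U).card)) - h)^[D + 1] g) U| ≤ R) :
    |∑ U : OddSet n, levelWeight n t C w U M * g U.1 +
        (Fintype.card (PMatch n) : ℝ)⁻¹ * (DesignRemainder.newtonPolyOdd D
          (fun c => (∑ U' ∈ shell M.2.partner t c, g U') / (shell M.2.partner t c).card)).eval 0| ≤
      (Fintype.card (PMatch n) : ℝ)⁻¹ * (Bv * ((((T - 1) / 2).choose (D + 1) : ℕ) : ℝ) * R) := by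
  have ht : Odd t := hdes.1
  have htn : 2 * t + 2 ≤ n := hdes.2.1
  have hTt : T ≤ t := hdes.2.2.1
  have hT3 : 3 ≤ T := by
    obtain ⟨c₀, hc₀⟩ := nonempty_of_exact hdes.exact
    exact (hdes.2.2.2.1 c₀ hc₀).2.1.trans (hdes.2.2.2.1 c₀ hc₀).2.2.1
  have hK := moveAvg_step M (cmax := T - 2) ht (by omega) (by omega)
  exact designValue_operator_bound_sup hdes M g _ hK hR0 (fun U hU => hR U hU)

end Concrete

end Summit.PneNP.PneNP.Theorems.ChebyshevTracialDesignShellOperatorForm
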